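import Mathlib
import Summits.NavierStokesRegularity.FluidComputer.TorusHighBandFluxCeiling
import HarnessLib

/-!
# The high-band energy budget from intermediate times and the high-band CEILING for periodic Navier–Stokes

HONEST FRAMING (cell `ns-blowup`, seat `ns-blowup-circuit` g6, human ruling D-0035): nothing here is a
claim about Navier–Stokes blow-up. WHAT THIS IS NOT: not a regularity criterion, not blow-up evidence.
Part 2 of `TorusHighBandFluxCeiling` (p445097): the same energy bookkeeping of the band `|k| > M` of a
Leray–Hopf solution of the TRUE Navier–Stokes equations on `T^d`, now (§1) from a.e. intermediate time
`s₀` (the tree's `energy_ineq_ae`), and (§2–§3) integrated in time to a POINTWISE CEILING for solutions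
whose high-band energy is continuous in time (classical solutions, energy-equality classes):
`‖Q_M u(t)‖₂ ≤ max(‖Q_M u(0)‖₂, G/(4π²ν(M²+1)))` whenever `K_M(u(s))‖u(s)‖₂ + ‖f(s)‖₂ ≤ G` for a.e.
`s` — the exact analogue, for NS itself, of `GalerkinFluxCeiling.sqrt_outsideEnergy_le_max` (p437361)
— and its contrapositive «high band above `max(initial, X)` ⇒ low-band ℓ¹-strain exceeded
`4π²ν(M²+1)X − ‖f‖₂)/‖u‖₂` on a set of earlier times of positive measure». Notation as in part 1
(`P_M = Torus.fourierTruncate M`, `Q_M v = v - P_M v`, `K_M = Torus.truncDerivBound M`,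
`tail_M = Torus.tailGradNormSq M`). No definitions.
-/

noncomputable section

open MeasureTheory Set Filter UnitAddTorus Function
open scoped ENNReal NNReal InnerProductSpace RealInnerProductSpace Topology

namespace Summit.NavierStokesRegularity.FluidComputer.TorusHighBandFluxCeiling

open Literature.Analysis Literature.Analysis.FunctionSpaces Literature.Analysis.FluidPDE

variable {d : Type*} [Fintype d] [DecidableEq d]

/-! ## §1 The budget from a.e. intermediate time -/

section FromTime

variable {T ν : ℝ} {f u : ℝ → UnitAddTorus d → EuclideanSpace ℝ d} {u₀ : UnitAddTorus d → EuclideanSpace ℝ d}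

/-- **HIGH-BAND ENERGY BUDGET FROM a.e. INTERMEDIATE TIME.** For a Leray–Hopf solution on
`T^d × [0,T)` (`T > 0`, jointly measurable `f ∈ L¹(0,T;L²)`, `u₀ ∈ L²`) and every band edge `M`:
for a.e. `s₀ ∈ (0,T)` and every `t ∈ [s₀, T]`,
`½‖Q_M u(t)‖² + ν∫_{s₀}^{t} tail_M(u) ≤ ½‖Q_M u(s₀)‖² + ∫_{(s₀,t]} (∫⟪f, Q_M u⟫ - ∫⟪Q_M u,(u·∇)P_M u⟫)`
(the energy inequality from a.e. `s₀`, `energy_ineq_ae`, minus one half of the DIFFERENCE of the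
level-`M` identities `Torus.IsLerayHopfOn.integral_inner_fourierTruncate_self_eq` at `t` and at `s₀`;
then as in `highBand_energy_budget`). [cite: FoiasManleyRosaTemam2001, Ch. V §5.1 (5.19)] -/
theorem highBand_energy_budget_ae (hu : FluidPDE.Torus.IsLerayHopfOn T ν f u₀ u) (hT : 0 < T)
    (hfm : AEStronglyMeasurable (Torus.stLift f) (volume.restrict (Ioo 0 T ×ˢ univ)))
    (hf : FluidPDE.Torus.MemLqLp 1 2 f (Ioo 0 T)) (hu₀ : MemLp u₀ 2 volume) (M : ℕ) :
    ∀ᵐ s₀ ∂(volume.restrict (Ioo 0 T)), ∀ t ∈ Icc s₀ T,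
      IntegrableOn (fun s => (∫ x, ⟪f s x, u s x - Torus.fourierTruncate M (u s) x⟫) -
            ∫ x, ⟪u s x - Torus.fourierTruncate M (u s) x,
              Torus.convect (u s) (Torus.fourierTruncate M (u s)) x⟫) (Ioc s₀ t) ∧
      Torus.kineticEnergy (u t - Torus.fourierTruncate M (u t)) +
          ν * (∫⁻ s in Ioo s₀ t, FluidPDE.Torus.tailGradNormSq M (u s)).toReal ≤
        Torus.kineticEnergy (u s₀ - Torus.fourierTruncate M (u s₀)) +
          ∫ s in Ioc s₀ t, ((∫ x, ⟪f s x, u s x - Torus.fourierTruncate M (u s) x⟫) -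
            ∫ x, ⟪u s x - Torus.fourierTruncate M (u s) x,
              Torus.convect (u s) (Torus.fourierTruncate M (u s)) x⟫) := by
  classical
  filter_upwards [hu.energy_ineq_ae, ae_restrict_mem measurableSet_Ioo] with s₀ hEs₀ hs₀
  intro t ht
  set P : ℝ → UnitAddTorus d → EuclideanSpace ℝ d := fun s => Torus.fourierTruncate M (u s) with hP
  have hs₀T : s₀ ∈ Ioc 0 T := ⟨hs₀.1, hs₀.2.le⟩
  have htT : t ∈ Ioc 0 T := ⟨hs₀.1.trans_le ht.1, ht.2⟩
  have hsub : Ioo s₀ t ⊆ Ioo 0 T := Ioo_subset_Ioo hs₀.1.le ht.2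
  have hle : volume.restrict (Ioo s₀ t) ≤ volume.restrict (Ioo 0 T) := Measure.restrict_mono hsub le_rfl
  have hmem : ∀ s ∈ Icc 0 T, MemLp (u s) 2 volume := hu.memLp
  have hut : MemLp (u t) 2 volume := hmem t ⟨htT.1.le, htT.2⟩
  have hus : MemLp (u s₀) 2 volume := hmem s₀ ⟨hs₀.1.le, hs₀.2.le⟩
  -- ### (1) the energy inequality from `s₀`
  have hE := hEs₀ t ht
  -- ### (2) the level-`M` identities at `t` and at `s₀`, subtracted
  obtain ⟨hΦint, hId⟩ := hu.integral_inner_fourierTruncate_self_eq hT hfm hf hu₀ M htT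
  obtain ⟨-, hIds⟩ := hu.integral_inner_fourierTruncate_self_eq hT hfm hf hu₀ M hs₀T
  have hΦs : IntegrableOn (fun s => ∫ x, (⟪u s x, Torus.convect (u s) (P s) x⟫ +
      ν * ⟪u s x, Torus.laplacian (P s) x⟫ + ⟪f s x, P s x⟫)) (Ioc s₀ t) :=
    hΦint.mono_set (Ioc_subset_Ioc_left hs₀.1.le)
  have hΦ0 : IntegrableOn (fun s => ∫ x, (⟪u s x, Torus.convect (u s) (P s) x⟫ +
      ν * ⟪u s x, Torus.laplacian (P s) x⟫ + ⟪f s x, P s x⟫)) (Ioc 0 s₀) :=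
    hΦint.mono_set (Ioc_subset_Ioc_right ht.1)
  have hsplitI : ∫ s in Ioc 0 t, (∫ x, (⟪u s x, Torus.convect (u s) (P s) x⟫ +
      ν * ⟪u s x, Torus.laplacian (P s) x⟫ + ⟪f s x, P s x⟫)) =
      (∫ s in Ioc 0 s₀, (∫ x, (⟪u s x, Torus.convect (u s) (P s) x⟫ +
        ν * ⟪u s x, Torus.laplacian (P s) x⟫ + ⟪f s x, P s x⟫))) +
      ∫ s in Ioc s₀ t, (∫ x, (⟪u s x, Torus.convect (u s) (P s) x⟫ +
        ν * ⟪u s x, Torus.laplacian (P s) x⟫ + ⟪f s x, P s x⟫)) := by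
    rw [← setIntegral_union (Ioc_disjoint_Ioc_of_le le_rfl) measurableSet_Ioc hΦ0 hΦs,
      Ioc_union_Ioc_eq_Ioc hs₀.1.le ht.1]
  -- integrability of the pieces on `(s₀, t]`
  have hG : IntegrableOn (fun s => (Torus.eGradNormSq (P s)).toReal) (Ioc s₀ t) :=
    ((hu.tendsto_setIntegral_toReal_eGradNormSq_fourierTruncate htT).1 M).mono_set
      (Ioc_subset_Ioc_left hs₀.1.le)
  have hWP : IntegrableOn (fun s => ∫ x, ⟪f s x, P s x⟫) (Ioc s₀ t) :=
    ((hu.tendsto_setIntegral_work_fourierTruncate hfm hf htT).1 M).mono_set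
      (Ioc_subset_Ioc_left hs₀.1.le)
  have hleC : volume.restrict (Ioc s₀ t) ≤ volume.restrict (Ioo 0 T) := by
    rw [← Measure.restrict_congr_set Ioo_ae_eq_Ioc]; exact hle
  have hfs2 : ∀ᵐ s ∂(volume.restrict (Ioc s₀ t)), MemLp (f s) 2 volume := ae_mono hleC hf.1
  have hsplit : ∀ᵐ s ∂(volume.restrict (Ioc s₀ t)),
      (∫ x, (⟪u s x, Torus.convect (u s) (P s) x⟫ + ν * ⟪u s x, Torus.laplacian (P s) x⟫ +
          ⟪f s x, P s x⟫)) =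
        (∫ x, ⟪u s x, Torus.convect (u s) (P s) x⟫) - ν * (Torus.eGradNormSq (P s)).toReal +
          ∫ x, ⟪f s x, P s x⟫ := by
    filter_upwards [hfs2, ae_restrict_mem measurableSet_Ioc] with s hfs' hs
    exact FluidPDE.Torus.flux_fourierTruncate_self_split
      (hmem s ⟨(hs₀.1.trans hs.1).le, hs.2.trans ht.2⟩) (hfs'.integrable one_le_two) ν M
  have hC : IntegrableOn (fun s => ∫ x, ⟪u s x, Torus.convect (u s) (P s) x⟫) (Ioc s₀ t) := by
    have h := (hΦs.add (hG.const_mul ν)).sub hWP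
    refine h.congr ?_
    filter_upwards [hsplit] with s hs
    simp only [Pi.add_apply, Pi.sub_apply]
    rw [hs]; ring
  have hId' : ∫ s in Ioc s₀ t, (∫ x, (⟪u s x, Torus.convect (u s) (P s) x⟫ +
      ν * ⟪u s x, Torus.laplacian (P s) x⟫ + ⟪f s x, P s x⟫)) =
      (∫ s in Ioc s₀ t, ∫ x, ⟪u s x, Torus.convect (u s) (P s) x⟫) -
        ν * (∫ s in Ioc s₀ t, (Torus.eGradNormSq (P s)).toReal) +
        ∫ s in Ioc s₀ t, ∫ x, ⟪f s x, P s x⟫ := by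
    have hG' : Integrable (fun s => ν * (Torus.eGradNormSq (P s)).toReal)
        (volume.restrict (Ioc s₀ t)) := hG.const_mul ν
    have hWP' : Integrable (fun s => ∫ x, ⟪f s x, P s x⟫) (volume.restrict (Ioc s₀ t)) := hWP
    have h1 : Integrable (fun s => (∫ x, ⟪u s x, Torus.convect (u s) (P s) x⟫) -
        ν * (Torus.eGradNormSq (P s)).toReal) (volume.restrict (Ioc s₀ t)) := hC.sub hG'
    rw [integral_congr_ae hsplit, integral_add h1 hWP', integral_sub hC hG', integral_const_mul]
  -- ### (3) the work against `u` itself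
  have hWu : IntegrableOn (fun s => ∫ x, ⟪f s x, u s x⟫) (Ioc s₀ t) := by
    have h := FluidPDE.Torus.WeakNSEnergyClass.integrableOn_work_L1L2 hu.weak hu.energy_bound
      hu.memLp hfm hf
    have h' : IntegrableOn (fun s => ∫ x, ⟪f s x, u s x⟫) (Ioo s₀ t) := h.mono_set hsub
    rwa [IntegrableOn, Measure.restrict_congr_set Ioo_ae_eq_Ioc] at h'
  have hWu_eq : ∫ τ in s₀..t, ∫ x, ⟪f τ x, u τ x⟫ = ∫ s in Ioc s₀ t, ∫ x, ⟪f s x, u s x⟫ :=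
    intervalIntegral.integral_of_le ht.1
  -- ### (4) the dissipation splits across the band edge
  have hmeasP : AEMeasurable (fun s => Torus.eGradNormSq (P s)) (volume.restrict (Ioo s₀ t)) :=
    (hu.aemeasurable_eGradNormSq_fourierTruncate M).mono_measure hle
  have hDsplit : ∫⁻ s in Ioo s₀ t, Torus.eGradNormSq (u s) =
      (∫⁻ s in Ioo s₀ t, Torus.eGradNormSq (P s)) +
        ∫⁻ s in Ioo s₀ t, FluidPDE.Torus.tailGradNormSq M (u s) := by
    rw [← lintegral_add_left' hmeasP]
    refine setLIntegral_congr_fun measurableSet_Ioo fun s hs => ?_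
    exact eGradNormSq_eq_add_tailGradNormSq
      ((hmem s ⟨(hs₀.1.trans hs.1).le, hs.2.le.trans ht.2⟩).integrable one_le_two) M
  have hDfin : ∫⁻ s in Ioo s₀ t, Torus.eGradNormSq (u s) ≠ ⊤ :=
    ((lintegral_mono' hle le_rfl).trans_lt hu.lintegral_eGradNormSq_lt_top).ne
  have hPfin : ∫⁻ s in Ioo s₀ t, Torus.eGradNormSq (P s) ≠ ⊤ :=
    ne_top_of_le_ne_top hDfin (hDsplit ▸ le_self_add)
  have hTfin : ∫⁻ s in Ioo s₀ t, FluidPDE.Torus.tailGradNormSq M (u s) ≠ ⊤ :=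
    ne_top_of_le_ne_top hDfin (hDsplit ▸ le_add_self)
  have hDreal : (∫⁻ s in Ioo s₀ t, Torus.eGradNormSq (u s)).toReal =
      (∫⁻ s in Ioo s₀ t, Torus.eGradNormSq (P s)).toReal +
        (∫⁻ s in Ioo s₀ t, FluidPDE.Torus.tailGradNormSq M (u s)).toReal := by
    rw [hDsplit, ENNReal.toReal_add hPfin hTfin]
  have hPreal : (∫⁻ s in Ioo s₀ t, Torus.eGradNormSq (P s)).toReal =
      ∫ s in Ioc s₀ t, (Torus.eGradNormSq (P s)).toReal := by
    have hfinN : ∀ᵐ s ∂(volume.restrict (Ioo s₀ t)), Torus.eGradNormSq (P s) < ⊤ :=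
      ae_of_all _ fun s => Torus.eGradNormSq_lt_top (Torus.isSmooth_fourierTruncate M _)
    rw [← integral_toReal hmeasP hfinN, setIntegral_congr_set Ioo_ae_eq_Ioc]
  -- ### (5) Pythagoras at `t` and at `s₀`
  have hQt := kineticEnergy_highBand_eq hut M
  have hQs := kineticEnergy_highBand_eq hus M
  -- ### (6) the right-hand side integrand, slice-wise
  have hRHS : ∫ s in Ioc s₀ t, ((∫ x, ⟪f s x, u s x - P s x⟫) -
      ∫ x, ⟪u s x - P s x, Torus.convect (u s) (P s) x⟫) =
      (∫ s in Ioc s₀ t, ∫ x, ⟪f s x, u s x⟫) - (∫ s in Ioc s₀ t, ∫ x, ⟪f s x, P s x⟫) -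
        ∫ s in Ioc s₀ t, ∫ x, ⟪u s x, Torus.convect (u s) (P s) x⟫ := by
    have hae : ∀ᵐ s ∂(volume.restrict (Ioc s₀ t)), ((∫ x, ⟪f s x, u s x - P s x⟫) -
        ∫ x, ⟪u s x - P s x, Torus.convect (u s) (P s) x⟫) =
        ((∫ x, ⟪f s x, u s x⟫) - ∫ x, ⟪f s x, P s x⟫) -
          ∫ x, ⟪u s x, Torus.convect (u s) (P s) x⟫ := by
      filter_upwards [hfs2, ae_restrict_mem measurableSet_Ioc] with s hfs' hs
      have hsT : s ∈ Ioc 0 T := ⟨hs₀.1.trans hs.1, hs.2.trans ht.2⟩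
      have hus' : MemLp (u s) 2 volume := hmem s ⟨hsT.1.le, hsT.2⟩
      have hPs : MemLp (P s) 2 volume := Torus.memLp_fourierTruncate M (u s) 2
      have hdiv : Torus.IsWeaklyDivFree (u s) := hu.isWeaklyDivFree_of_mem_Ioc hsT
      rw [← integral_inner_convect_fourierTruncate_self_eq_highBand hus' hdiv M,
        ← integral_sub (FluidPDE.integrable_inner_of_memLp_two hfs' hus')
          (FluidPDE.integrable_inner_of_memLp_two hfs' hPs)]
      congr 1
      refine integral_congr_ae (ae_of_all _ fun x => ?_)
      simp only [inner_sub_right]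
    have hWP' : Integrable (fun s => ∫ x, ⟪f s x, P s x⟫) (volume.restrict (Ioc s₀ t)) := hWP
    have h2 : Integrable (fun s => (∫ x, ⟪f s x, u s x⟫) - ∫ x, ⟪f s x, P s x⟫)
        (volume.restrict (Ioc s₀ t)) := hWu.sub hWP'
    rw [integral_congr_ae hae, integral_sub h2 hC, integral_sub hWu hWP']
  have hInt : IntegrableOn (fun s => (∫ x, ⟪f s x, u s x - P s x⟫) -
      ∫ x, ⟪u s x - P s x, Torus.convect (u s) (P s) x⟫) (Ioc s₀ t) := by
    have hWP' : Integrable (fun s => ∫ x, ⟪f s x, P s x⟫) (volume.restrict (Ioc s₀ t)) := hWP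
    have h2 : Integrable (fun s => ((∫ x, ⟪f s x, u s x⟫) - ∫ x, ⟪f s x, P s x⟫) -
        ∫ x, ⟪u s x, Torus.convect (u s) (P s) x⟫) (volume.restrict (Ioc s₀ t)) :=
      (hWu.sub hWP').sub hC
    refine h2.congr ?_
    filter_upwards [hfs2, ae_restrict_mem measurableSet_Ioc] with s hfs' hs
    have hsT : s ∈ Ioc 0 T := ⟨hs₀.1.trans hs.1, hs.2.trans ht.2⟩
    have hus' : MemLp (u s) 2 volume := hmem s ⟨hsT.1.le, hsT.2⟩
    have hPs : MemLp (P s) 2 volume := Torus.memLp_fourierTruncate M (u s) 2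
    have hdiv : Torus.IsWeaklyDivFree (u s) := hu.isWeaklyDivFree_of_mem_Ioc hsT
    rw [← integral_inner_convect_fourierTruncate_self_eq_highBand hus' hdiv M,
      ← integral_sub (FluidPDE.integrable_inner_of_memLp_two hfs' hus')
        (FluidPDE.integrable_inner_of_memLp_two hfs' hPs)]
    congr 1
    refine integral_congr_ae (ae_of_all _ fun x => ?_)
    simp only [inner_sub_right]
  refine ⟨hInt, ?_⟩
  -- ### (7) assemble
  rw [hRHS, hQt, hQs]
  rw [hWu_eq, hDreal, hPreal] at hE
  rw [hsplitI, hId'] at hId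
  nlinarith [hE, hId, hIds]

end FromTime

/-! ## §2 A real-variable ceiling lemma (first-crossing argument) -/

section Ceiling

/-- **Ceiling from an a.e.-started integral inequality.** Let `e` be continuous and nonnegative on
`[0, T']`, `lam > 0`, `G ∈ ℝ`, and suppose that for a.e. `s₀ ∈ (0, T')` and every `t ∈ [s₀, T']`,
`e t ≤ e s₀ + ∫_{(s₀,t]} (G √(2 e s) - 2 lam e s) ds`. Then `√(2 e t) ≤ max(√(2 e 0), G/lam)` for all
`t ∈ [0, T']`. (If `e` exceeded the level `C = c²/2`, `c` the right side, at `t₁`, let `t₀` be the last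
time `≤ t₁` with `e ≤ C`; on `(t₀, t₁]` the integrand is `≤ 0`, so `e t₁ ≤ e s₀` for a.e.
`s₀ ∈ (t₀, t₁)`, and continuity at `t₀` gives `e t₁ ≤ C`.) [folklore] -/
theorem sqrt_le_max_of_ae_integral_ineq {T' lam G : ℝ} {e : ℝ → ℝ} (hlam : 0 < lam)
    (hcont : ContinuousOn e (Icc 0 T')) (he : ∀ t ∈ Icc 0 T', 0 ≤ e t)
    (H : ∀ᵐ s₀ ∂(volume.restrict (Ioo 0 T')), ∀ t ∈ Icc s₀ T',
      e t ≤ e s₀ + ∫ s in Ioc s₀ t, (G * Real.sqrt (2 * e s) - 2 * lam * e s)) :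
    ∀ t ∈ Icc 0 T', Real.sqrt (2 * e t) ≤ max (Real.sqrt (2 * e 0)) (G / lam) := by
  set c : ℝ := max (Real.sqrt (2 * e 0)) (G / lam) with hc
  set C : ℝ := c ^ 2 / 2 with hC
  have hc0 : 0 ≤ c := le_max_of_le_left (Real.sqrt_nonneg _)
  -- it suffices to bound `e` by `C`
  suffices hmain : ∀ t ∈ Icc 0 T', e t ≤ C by
    intro t ht
    have h1 : 2 * e t ≤ c ^ 2 := by have := hmain t ht; rw [hC] at this; linarith
    calc Real.sqrt (2 * e t) ≤ Real.sqrt (c ^ 2) := Real.sqrt_le_sqrt h1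
      _ = c := Real.sqrt_sq hc0
  have he0C : e 0 ≤ C := by
    by_cases hT' : 0 ≤ T'
    · have h0 : Real.sqrt (2 * e 0) ≤ c := le_max_left _ _
      have h00 : 0 ≤ e 0 := he 0 ⟨le_rfl, hT'⟩
      have h1 : 2 * e 0 ≤ c ^ 2 := by
        calc 2 * e 0 = Real.sqrt (2 * e 0) ^ 2 := (Real.sq_sqrt (by linarith)).symm
          _ ≤ c ^ 2 := pow_le_pow_left₀ (Real.sqrt_nonneg _) h0 2
      rw [hC]; linarith
    · -- `[0, T']` is empty: nothing to prove later, but we still record the bound formally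
      have h0 : Real.sqrt (2 * e 0) ≤ c := le_max_left _ _
      by_contra hlt
      have hlt := not_le.1 hlt
      have h00 : 0 < e 0 := lt_of_le_of_lt (by rw [hC]; positivity) hlt
      have h1 : 2 * e 0 ≤ c ^ 2 := by
        calc 2 * e 0 = Real.sqrt (2 * e 0) ^ 2 := (Real.sq_sqrt (by linarith)).symm
          _ ≤ c ^ 2 := pow_le_pow_left₀ (Real.sqrt_nonneg _) h0 2
      rw [hC] at hlt; linarith
  -- the integrand is nonpositive where `e > C`
  have hneg : ∀ s, C < e s → G * Real.sqrt (2 * e s) - 2 * lam * e s ≤ 0 := by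
    intro s hs
    have hes : 0 ≤ 2 * e s := by rw [hC] at hs; nlinarith [sq_nonneg c]
    have hsq : c < Real.sqrt (2 * e s) := by
      rw [← Real.sqrt_sq hc0]
      refine Real.sqrt_lt_sqrt (sq_nonneg _) ?_
      rw [hC] at hs; linarith
    have hGl : G ≤ lam * Real.sqrt (2 * e s) := by
      have h1 : G / lam ≤ c := le_max_right _ _
      rw [div_le_iff₀ hlam] at h1
      nlinarith [h1, hsq, hlam.le]
    have h2 : G * Real.sqrt (2 * e s) ≤ lam * Real.sqrt (2 * e s) * Real.sqrt (2 * e s) :=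
      mul_le_mul_of_nonneg_right hGl (Real.sqrt_nonneg _)
    rw [mul_assoc, Real.mul_self_sqrt hes] at h2
    linarith
  -- first-crossing argument
  by_contra hbad
  simp only [not_forall, not_le] at hbad
  obtain ⟨t₁, ht₁, hCt₁⟩ := hbad
  set A : Set ℝ := Icc 0 t₁ ∩ e ⁻¹' Iic C with hA
  have hAcl : IsClosed A :=
    (hcont.mono (Icc_subset_Icc_right ht₁.2)).preimage_isClosed_of_isClosed isClosed_Icc isClosed_Iic
  have hAne : A.Nonempty := ⟨0, ⟨⟨le_rfl, ht₁.1⟩, he0C⟩⟩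
  have hAbdd : BddAbove A := ⟨t₁, fun s hs => hs.1.2⟩
  set t₀ := sSup A with ht₀
  have ht₀A : t₀ ∈ A := hAcl.csSup_mem hAne hAbdd
  have ht₀le : t₀ ≤ t₁ := csSup_le hAne fun s hs => hs.1.2
  have het₀ : e t₀ ≤ C := ht₀A.2
  have ht₀lt : t₀ < t₁ := lt_of_le_of_ne ht₀le fun h => by
    rw [h] at het₀; exact absurd het₀ (not_le.2 hCt₁)
  have habove : ∀ s ∈ Ioc t₀ t₁, C < e s := by
    intro s hs
    by_contra hle
    have hle := not_lt.1 hle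
    have hsA : s ∈ A := ⟨⟨ht₀A.1.1.trans hs.1.le, hs.2⟩, hle⟩
    exact absurd (le_csSup hAbdd hsA) (not_le.2 hs.1)
  -- for every good `s₀ ∈ (t₀, t₁)`, `e t₁ ≤ e s₀`
  have hgood : ∀ s₀ ∈ Ioo t₀ t₁, (∀ t ∈ Icc s₀ T',
      e t ≤ e s₀ + ∫ s in Ioc s₀ t, (G * Real.sqrt (2 * e s) - 2 * lam * e s)) → e t₁ ≤ e s₀ := by
    intro s₀ hs₀ hH
    have h := hH t₁ ⟨hs₀.2.le, ht₁.2⟩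
    have hint : ∫ s in Ioc s₀ t₁, (G * Real.sqrt (2 * e s) - 2 * lam * e s) ≤ 0 :=
      setIntegral_nonpos measurableSet_Ioc fun s hs => hneg s (habove s ⟨hs₀.1.trans hs.1, hs.2⟩)
    linarith
  -- continuity of `e` at `t₀` within `[0, T']`
  have ht₀I : t₀ ∈ Icc 0 T' := ⟨ht₀A.1.1, ht₀le.trans ht₁.2⟩
  have hcw := Metric.continuousWithinAt_iff.1 (hcont t₀ ht₀I) (e t₁ - C) (by linarith)
  obtain ⟨δ, hδ, hδe⟩ := hcw
  -- a good `s₀` in `(t₀, min t₁ (t₀ + δ))`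
  set t₂ : ℝ := min t₁ (t₀ + δ) with ht₂
  have ht₀t₂ : t₀ < t₂ := lt_min ht₀lt (by linarith)
  have hsub : Ioo t₀ t₂ ⊆ Ioo 0 T' := Ioo_subset_Ioo ht₀I.1 ((min_le_left _ _).trans ht₁.2)
  have H2 : ∀ᵐ s₀ ∂(volume.restrict (Ioo t₀ t₂)), s₀ ∈ Ioo t₀ t₂ ∧ ∀ t ∈ Icc s₀ T',
      e t ≤ e s₀ + ∫ s in Ioc s₀ t, (G * Real.sqrt (2 * e s) - 2 * lam * e s) := by
    filter_upwards [ae_restrict_mem measurableSet_Ioo,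
      ae_mono (Measure.restrict_mono hsub le_rfl) H] with s hs h using ⟨hs, h⟩
  haveI : (ae (volume.restrict (Ioo t₀ t₂))).NeBot := by
    rw [ae_restrict_neBot, Real.volume_Ioo]; exact (ENNReal.ofReal_pos.2 (by linarith)).ne'
  obtain ⟨s₀, hs₀, hHs₀⟩ := H2.exists
  have hs₀1 : s₀ ∈ Ioo t₀ t₁ := ⟨hs₀.1, hs₀.2.trans_le (min_le_left _ _)⟩
  have h1 := hgood s₀ hs₀1 hHs₀
  have hs₀I : s₀ ∈ Icc 0 T' := ⟨ht₀I.1.trans hs₀.1.le, hs₀1.2.le.trans ht₁.2⟩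
  have hdist : dist s₀ t₀ < δ := by
    rw [Real.dist_eq, abs_of_pos (by linarith [hs₀.1])]
    linarith [hs₀.2, min_le_right t₁ (t₀ + δ)]
  have h2 := hδe hs₀I hdist
  rw [Real.dist_eq] at h2
  have h3 := (abs_lt.1 h2).2
  linarith

end Ceiling

end Summit.NavierStokesRegularity.FluidComputer.TorusHighBandFluxCeiling
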